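import Mathlib
import Summits.MatrixMultiplication.MatrixMultiplication.Theorems.GroupTheoreticSTPPCThesisFatPartnersLines

/-!
# Fat partners of a frame triple in `(ℤ/n)³` — abstract core, II: if `X` is a line, so are `Y` and `Z` (STEP 3)

Support file for route `MatrixMultiplication/GroupTheoreticSTPP` (target `CThesis`, stmt-MatrixMultiplication-0593),
cell `mm-stpp` (D-0046), theory statement S9 «fat-partner rigidity» (HOME/mm-stpp-theory/FAT-PARTNERS.md);
sequel of `…FatPartnersLines.lean` (same abstract, cyclically symmetric constraint system `fXY, fYZ, fZX,
gX, gY, gZ, hinj` on three `(n−1)`-sets `X, Y, Z ⊆ (ℤ/n)³` and coordinates `p, q, r`).  Here `n ≥ 4`.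

* `lines_of_line_q` (STEP 3): if `X` lies on a line of direction `e_q` then `Y` lies on a line of direction
  `e_r` and `Z` on a line of direction `e_p` (after which `partner_of_lines_rot` applies);
* `lines_of_line_r` (STEP 3′): if `X ∥ e_r` then `Y ∥ e_p` and `Z ∥ e_q` (then `partner_of_lines_rot2`).
(Direction `e_p` is impossible: `not_line_p`.)  Tools: sum-injectivity makes the two other sets graphs over
one coordinate, a three-element majority argument (`exists_and_of_pairwise`) fixes a second coordinate, and
the three-line conditions kill the single possible stray point.

WHAT THIS IS NOT: the assembled rigidity theorem (STEP 0/1, the sequel); nothing about `ω`.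

## References
* H. Cohn, R. Kleinberg, B. Szegedy, C. Umans, FOCS 2005, Def. 5.1, Prop. 5.2.
-/

-- single-conjunct summit: the mandated namespace repeats `MatrixMultiplication`.
set_option linter.dupNamespace false

namespace Summit.MatrixMultiplication.MatrixMultiplication.Theorems

namespace FatPartners

open Finset

variable {n : ℕ}

/-- **Majority among three.**  If a set has at least three elements and each of two properties fails on
at most one element (of any two distinct elements one has it), some element has both. [folklore] -/
theorem exists_and_of_pairwise {ι : Type*} {S : Finset ι} (h : 2 < S.card) {P Q : ι → Prop}
    (hP : ∀ s ∈ S, ∀ s' ∈ S, s ≠ s' → P s ∨ P s') (hQ : ∀ s ∈ S, ∀ s' ∈ S, s ≠ s' → Q s ∨ Q s') :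
    ∃ s ∈ S, P s ∧ Q s := by
  obtain ⟨x, hx, y, hy, z, hz, hxy, hxz, hyz⟩ := Finset.two_lt_card.1 h
  by_contra hno
  have hno' : ∀ s ∈ S, P s → ¬ Q s := fun s hs hPs hQs => hno ⟨s, hs, hPs, hQs⟩
  rcases hP x hx y hy hxy with hPx | hPy
  · rcases hP y hy z hz hyz with hPy | hPz
    · rcases hQ x hx y hy hxy with hQx | hQy
      · exact hno' x hx hPx hQx
      · exact hno' y hy hPy hQy
    · rcases hQ x hx z hz hxz with hQx | hQz
      · exact hno' x hx hPx hQx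
      · exact hno' z hz hPz hQz
  · rcases hP x hx z hz hxz with hPx | hPz
    · rcases hQ x hx y hy hxy with hQx | hQy
      · exact hno' x hx hPx hQx
      · exact hno' y hy hPy hQy
    · rcases hQ y hy z hz hyz with hQy | hQz
      · exact hno' y hy hPy hQy
      · exact hno' z hz hPz hQz

section Abstract

variable [NeZero n] {X Y Z : Finset (Fin 3 → ZMod n)} {p q r : Fin 3} (hn : 4 ≤ n)
  (hcov : ∀ i : Fin 3, i = p ∨ i = q ∨ i = r)
  (fXY : ∀ x ∈ X, ∀ y ∈ Y, x p = y p ∨ x q = y q)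
  (fYZ : ∀ y ∈ Y, ∀ z ∈ Z, y q = z q ∨ y r = z r)
  (fZX : ∀ z ∈ Z, ∀ x ∈ X, z r = x r ∨ z p = x p)
  (gX : ∀ x ∈ X, ∀ x' ∈ X, ∀ y ∈ Y, ∀ z' ∈ Z,
    (x - x' + (y - z')) q = 0 ∨ (x - x' + (y - z')) r = 0 ∨ (x - x' + (y - z')) p ≠ 0)
  (gY : ∀ y ∈ Y, ∀ y' ∈ Y, ∀ z ∈ Z, ∀ x' ∈ X,
    (y - y' + (z - x')) r = 0 ∨ (y - y' + (z - x')) p = 0 ∨ (y - y' + (z - x')) q ≠ 0)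
  (gZ : ∀ z ∈ Z, ∀ z' ∈ Z, ∀ x ∈ X, ∀ y' ∈ Y,
    (z - z' + (x - y')) p = 0 ∨ (z - z' + (x - y')) q = 0 ∨ (z - z' + (x - y')) r ≠ 0)
  (hinj : ∀ x ∈ X, ∀ x' ∈ X, ∀ y ∈ Y, ∀ y' ∈ Y, ∀ z ∈ Z, ∀ z' ∈ Z,
    x + y + z = x' + y' + z' → x = x' ∧ y = y' ∧ z = z')
  (hXc : X.card = n - 1) (hYc : Y.card = n - 1) (hZc : Z.card = n - 1)

include hn hcov fXY fYZ fZX gX gZ hinj hXc hYc hZc in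
/-- **STEP 3.**  If `X` lies on a line of direction `e_q` (`x_p = a_p`, `x_r = a_r`), then `Y` lies on a
line of direction `e_r` (through `x_p = a_p`) and `Z` on a line of direction `e_p`.
[cite: CohnKleinbergSzegedyUmans2005, Def. 5.1] -/
theorem lines_of_line_q {a_p a_r : ZMod n} (hXl : ∀ x ∈ X, x p = a_p ∧ x r = a_r) :
    ∃ b_q c_q c_r : ZMod n, (∀ y ∈ Y, y p = a_p ∧ y q = b_q) ∧ (∀ z ∈ Z, z q = c_q ∧ z r = c_r) := by
  have hn3 : 3 ≤ n := le_trans (by norm_num) hn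
  obtain ⟨c1, c2, -, -, -⟩ := covers hcov
  obtain ⟨x₁, hx₁, x₂, hx₂, hxne⟩ := exists_pair_of_line hn3 c2 hXl hXc
  have hXinj : Set.InjOn (fun x : Fin 3 → ZMod n => x q) ↑X :=
    fun x hx x' hx' h => eq_of_line c2 hXl hx hx' h
  have hQ : (X.image fun x => x q).card = n - 1 := by rw [Finset.card_image_of_injOn hXinj, hXc]
  -- (1) `Y ⊆ {x_p = a_p}`
  have hYp : ∀ y ∈ Y, y p = a_p := fst_eq_of_line_q hn3 hcov fXY hXc hXl
  -- (2) `Z ⊆ cross`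
  have hZx : ∀ z ∈ Z, z p = a_p ∨ z r = a_r := by
    intro z hz
    rcases fZX z hz x₁ hx₁ with h | h
    · exact Or.inr (h.trans (hXl x₁ hx₁).2)
    · exact Or.inl (h.trans (hXl x₁ hx₁).1)
  obtain ⟨z₀, hz₀⟩ : Z.Nonempty := by rw [← Finset.card_pos, hZc]; omega
  -- (3) `Y` is a graph over coordinate `r`
  have hYinj : ∀ y ∈ Y, ∀ y' ∈ Y, y r = y' r → y = y' := by
    intro y hy y' hy' hrr
    obtain ⟨u, hu, u', hu', huu⟩ := exists_add_eq_add hn3 hQ hQ (y q) (y' q)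
    obtain ⟨x, hx, rfl⟩ := Finset.mem_image.1 hu
    obtain ⟨x', hx', rfl⟩ := Finset.mem_image.1 hu'
    have hsum : x + y + z₀ = x' + y' + z₀ := by
      funext i; rcases hcov i with rfl | rfl | rfl
      · simp [(hXl x hx).1, (hXl x' hx').1, hYp y hy, hYp y' hy']
      · simpa [add_comm, add_left_comm, add_assoc] using congrArg (· + z₀ i) huu
      · simp [(hXl x hx).2, (hXl x' hx').2, hrr]
    exact (hinj x hx x' hx' y hy y' hy' z₀ hz₀ z₀ hz₀ hsum).2.1
  -- (4) all but at most one `y` agree with any `z` in coordinate `q`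
  have hmaj : ∀ z ∈ Z, ∀ y ∈ Y, ∀ y' ∈ Y, y ≠ y' → y q = z q ∨ y' q = z q := by
    intro z hz y hy y' hy' hne
    rcases fYZ y hy z hz with h | h
    · exact Or.inl h
    rcases fYZ y' hy' z hz with h' | h'
    · exact Or.inr h'
    exact absurd (hYinj y hy y' hy' (h.trans h'.symm)) hne
  -- (5) all `z` share coordinate `q`
  have hY3 : 2 < Y.card := by rw [hYc]; omega
  have hγ : ∀ z ∈ Z, z q = z₀ q := by
    intro z hz
    obtain ⟨y, -, h1, h2⟩ := exists_and_of_pairwise hY3 (hmaj z hz) (hmaj z₀ hz₀)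
    exact h1.symm.trans h2
  -- (6) an exceptional `y` (with `y q ≠ z₀ q`) pins all `z r`
  have hexc : ∀ y ∈ Y, y q ≠ z₀ q → ∀ z ∈ Z, z r = y r := by
    intro y hy hyq z hz
    rcases fYZ y hy z hz with h | h
    · exact absurd (h.trans (hγ z hz)) hyq
    · exact h.symm
  by_cases hE : ∃ y ∈ Y, y q ≠ z₀ q
  · -- the exceptional case is contradictory
    exfalso
    obtain ⟨ys, hys, hysq⟩ := hE
    have hZl : ∀ z ∈ Z, z q = z₀ q ∧ z r = ys r := fun z hz => ⟨hγ z hz, hexc ys hys hysq z hz⟩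
    obtain ⟨z₁, hz₁, z₂, hz₂, hzne⟩ := exists_pair_of_line hn3 c1 hZl hZc
    have hyr : ys r = a_r := by
      by_cases h : z₁ p = a_p
      · have h' : z₂ p ≠ a_p := fun h' => hzne (h.trans h'.symm)
        rcases hZx z₂ hz₂ with h'' | h''
        · exact absurd h'' h'
        · rw [← (hZl z₂ hz₂).2, h'']
      · rcases hZx z₁ hz₁ with h'' | h''
        · exact absurd h'' h
        · rw [← (hZl z₁ hz₁).2, h'']
    obtain ⟨x, hx, hxq⟩ : ∃ x ∈ X, x q ≠ ys q := by
      by_cases h : x₁ q = ys q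
      · exact ⟨x₂, hx₂, fun h' => hxne (h.trans h'.symm)⟩
      · exact ⟨x₁, hx₁, h⟩
    rcases gZ z₁ hz₁ z₂ hz₂ x hx ys hys with h | h | h
    · exact hzne (by simpa [(hXl x hx).1, hYp ys hys, sub_eq_zero] using h)
    · exact hxq (by simpa [(hZl z₁ hz₁).1, (hZl z₂ hz₂).1, sub_eq_zero] using h)
    · exact h (by simp [(hZl z₁ hz₁).2, (hZl z₂ hz₂).2, (hXl x hx).2, hyr])
  · -- no exceptional `y`: `Y ∥ e_r`; then `Z ∥ e_p`
    push Not at hE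
    have hYl : ∀ y ∈ Y, y p = a_p ∧ y q = z₀ q := fun y hy => ⟨hYp y hy, hE y hy⟩
    have hYinj' : Set.InjOn (fun y : Fin 3 → ZMod n => y r) ↑Y :=
      fun y hy y' hy' h => eq_of_line hcov hYl hy hy' h
    have hW : (Y.image fun y => y r).card = n - 1 := by rw [Finset.card_image_of_injOn hYinj', hYc]
    -- `Z` is a graph over coordinate `p`
    have hZinj : ∀ z ∈ Z, ∀ z' ∈ Z, z p = z' p → z = z' := by
      intro z hz z' hz' h0
      obtain ⟨w, hw, w', hw', hww⟩ := exists_add_eq_add hn3 hW hW (z r) (z' r)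
      obtain ⟨y, hy, rfl⟩ := Finset.mem_image.1 hw
      obtain ⟨y', hy', rfl⟩ := Finset.mem_image.1 hw'
      have hsum : x₁ + y + z = x₁ + y' + z' := by
        funext i; rcases hcov i with rfl | rfl | rfl
        · simp [(hYl y hy).1, (hYl y' hy').1, h0]
        · simp [(hYl y hy).2, (hYl y' hy').2, hγ z hz, hγ z' hz']
        · simpa [add_comm, add_left_comm, add_assoc] using congrArg (· + x₁ i) hww
      exact (hinj x₁ hx₁ x₁ hx₁ y hy y' hy' z hz z' hz' hsum).2.2
    -- a `z` on `x_p = a_p` also has `z_r = a_r` (else `gX` is violated)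
    have hZr : ∀ z ∈ Z, z r = a_r := by
      intro z hz
      rcases hZx z hz with h0 | h2
      · by_contra hzr
        obtain ⟨y, hy, hyr⟩ : ∃ y ∈ Y, y r ≠ z r := by
          obtain ⟨y₁, hy₁, y₂, hy₂, hyne⟩ := exists_pair_of_line hn3 hcov hYl hYc
          by_cases h : y₁ r = z r
          · exact ⟨y₂, hy₂, fun h' => hyne (h.trans h'.symm)⟩
          · exact ⟨y₁, hy₁, h⟩
        rcases gX x₁ hx₁ x₂ hx₂ y hy z hz with h | h | h
        · exact hxne (by simpa [(hYl y hy).2, hγ z hz, sub_eq_zero] using h)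
        · exact hyr (by simpa [(hXl x₁ hx₁).2, (hXl x₂ hx₂).2, sub_eq_zero] using h)
        · exact h (by simp [(hXl x₁ hx₁).1, (hXl x₂ hx₂).1, (hYl y hy).1, h0])
      · exact h2
    exact ⟨z₀ q, z₀ q, a_r, hYl, fun z hz => ⟨hγ z hz, hZr z hz⟩⟩

include hn hcov fXY fYZ fZX gX gY hinj hXc hYc hZc in
/-- **STEP 3′.**  If `X` lies on a line of direction `e_r` (`x_p = a_p`, `x_q = a_q`), then `Y` lies on a
line of direction `e_p` and `Z` on a line of direction `e_q` (through `x_p = a_p`).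
[cite: CohnKleinbergSzegedyUmans2005, Def. 5.1] -/
theorem lines_of_line_r {a_p a_q : ZMod n} (hXl : ∀ x ∈ X, x p = a_p ∧ x q = a_q) :
    ∃ b_q b_r c_r : ZMod n, (∀ y ∈ Y, y q = b_q ∧ y r = b_r) ∧ (∀ z ∈ Z, z p = a_p ∧ z r = c_r) := by
  have hn3 : 3 ≤ n := le_trans (by norm_num) hn
  obtain ⟨c1, c2, -, -, -⟩ := covers hcov
  obtain ⟨x₁, hx₁, x₂, hx₂, hxne⟩ := exists_pair_of_line hn3 hcov hXl hXc
  have hXinj : Set.InjOn (fun x : Fin 3 → ZMod n => x r) ↑X :=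
    fun x hx x' hx' h => eq_of_line hcov hXl hx hx' h
  have hR : (X.image fun x => x r).card = n - 1 := by rw [Finset.card_image_of_injOn hXinj, hXc]
  -- (1) `Z ⊆ {x_p = a_p}`
  have hZp : ∀ z ∈ Z, z p = a_p := by
    intro z hz
    rcases fZX z hz x₁ hx₁ with h | h
    · rcases fZX z hz x₂ hx₂ with h' | h'
      · exact absurd (h.symm.trans h') hxne
      · exact h'.trans (hXl x₂ hx₂).1
    · exact h.trans (hXl x₁ hx₁).1
  -- (2) `Y ⊆ cross`
  have hYx : ∀ y ∈ Y, y p = a_p ∨ y q = a_q := by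
    intro y hy
    rcases fXY x₁ hx₁ y hy with h | h
    · exact Or.inl (h.symm.trans (hXl x₁ hx₁).1)
    · exact Or.inr (h.symm.trans (hXl x₁ hx₁).2)
  obtain ⟨y₀, hy₀⟩ : Y.Nonempty := by rw [← Finset.card_pos, hYc]; omega
  -- (3) `Z` is a graph over coordinate `q`
  have hZinj : ∀ z ∈ Z, ∀ z' ∈ Z, z q = z' q → z = z' := by
    intro z hz z' hz' hqq
    obtain ⟨u, hu, u', hu', huu⟩ := exists_add_eq_add hn3 hR hR (z r) (z' r)
    obtain ⟨x, hx, rfl⟩ := Finset.mem_image.1 hu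
    obtain ⟨x', hx', rfl⟩ := Finset.mem_image.1 hu'
    have hsum : x + y₀ + z = x' + y₀ + z' := by
      funext i; rcases hcov i with rfl | rfl | rfl
      · simp [(hXl x hx).1, (hXl x' hx').1, hZp z hz, hZp z' hz']
      · simp [(hXl x hx).2, (hXl x' hx').2, hqq]
      · simpa [add_comm, add_left_comm, add_assoc] using congrArg (· + y₀ i) huu
    exact (hinj x hx x' hx' y₀ hy₀ y₀ hy₀ z hz z' hz' hsum).2.2
  -- (4) all but at most one `z` agree with any `y` in coordinate `r`
  have hmaj : ∀ y ∈ Y, ∀ z ∈ Z, ∀ z' ∈ Z, z ≠ z' → z r = y r ∨ z' r = y r := by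
    intro y hy z hz z' hz' hne
    rcases fYZ y hy z hz with h | h
    · rcases fYZ y hy z' hz' with h' | h'
      · exact absurd (hZinj z hz z' hz' (h.symm.trans h')) hne
      · exact Or.inr h'.symm
    · exact Or.inl h.symm
  -- (5) all `y` share coordinate `r`
  have hZ3 : 2 < Z.card := by rw [hZc]; omega
  have hβ : ∀ y ∈ Y, y r = y₀ r := by
    intro y hy
    obtain ⟨z, -, h1, h2⟩ := exists_and_of_pairwise hZ3 (hmaj y hy) (hmaj y₀ hy₀)
    exact h1.symm.trans h2
  -- (6) an exceptional `z` (with `z r ≠ y₀ r`) pins all `y q`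
  have hexc : ∀ z ∈ Z, z r ≠ y₀ r → ∀ y ∈ Y, y q = z q := by
    intro z hz hzr y hy
    rcases fYZ y hy z hz with h | h
    · exact h
    · exact absurd (h.symm.trans (hβ y hy)) hzr
  by_cases hE : ∃ z ∈ Z, z r ≠ y₀ r
  · exfalso
    obtain ⟨zs, hzs, hzsr⟩ := hE
    have hYl : ∀ y ∈ Y, y q = zs q ∧ y r = y₀ r := fun y hy => ⟨hexc zs hzs hzsr y hy, hβ y hy⟩
    obtain ⟨y₁, hy₁, y₂, hy₂, hyne⟩ := exists_pair_of_line hn3 c1 hYl hYc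
    have hzq : zs q = a_q := by
      by_cases h : y₁ p = a_p
      · have h' : y₂ p ≠ a_p := fun h' => hyne (h.trans h'.symm)
        rcases hYx y₂ hy₂ with h'' | h''
        · exact absurd h'' h'
        · rw [← (hYl y₂ hy₂).1, h'']
      · rcases hYx y₁ hy₁ with h'' | h''
        · exact absurd h'' h
        · rw [← (hYl y₁ hy₁).1, h'']
    obtain ⟨x, hx, hxr⟩ : ∃ x ∈ X, x r ≠ zs r := by
      by_cases h : x₁ r = zs r
      · exact ⟨x₂, hx₂, fun h' => hxne (h.trans h'.symm)⟩
      · exact ⟨x₁, hx₁, h⟩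
    rcases gY y₁ hy₁ y₂ hy₂ zs hzs x hx with h | h | h
    · have h' : zs r = x r := by simpa [(hYl y₁ hy₁).2, (hYl y₂ hy₂).2, sub_eq_zero] using h
      exact hxr h'.symm
    · exact hyne (by simpa [hZp zs hzs, (hXl x hx).1, sub_eq_zero] using h)
    · exact h (by simp [(hYl y₁ hy₁).1, (hYl y₂ hy₂).1, hzq, (hXl x hx).2])
  · push Not at hE
    have hZl : ∀ z ∈ Z, z p = a_p ∧ z r = y₀ r := fun z hz => ⟨hZp z hz, hE z hz⟩
    have hZinj' : Set.InjOn (fun z : Fin 3 → ZMod n => z q) ↑Z :=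
      fun z hz z' hz' h => eq_of_line c2 hZl hz hz' h
    have hW : (Z.image fun z => z q).card = n - 1 := by rw [Finset.card_image_of_injOn hZinj', hZc]
    -- `Y` is a graph over coordinate `p`
    have hYinj : ∀ y ∈ Y, ∀ y' ∈ Y, y p = y' p → y = y' := by
      intro y hy y' hy' h0
      obtain ⟨w, hw, w', hw', hww⟩ := exists_add_eq_add hn3 hW hW (y q) (y' q)
      obtain ⟨z, hz, rfl⟩ := Finset.mem_image.1 hw
      obtain ⟨z', hz', rfl⟩ := Finset.mem_image.1 hw'
      have hsum : x₁ + y + z = x₁ + y' + z' := by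
        funext i; rcases hcov i with rfl | rfl | rfl
        · simp [(hZl z hz).1, (hZl z' hz').1, h0]
        · simpa [add_comm, add_left_comm, add_assoc] using congrArg (· + x₁ i) hww
        · simp [(hZl z hz).2, (hZl z' hz').2, hβ y hy, hβ y' hy']
      exact (hinj x₁ hx₁ x₁ hx₁ y hy y' hy' z hz z' hz' hsum).2.1
    -- a `y` on `x_p = a_p` also has `y_q = a_q` (else `gX` is violated)
    have hYq : ∀ y ∈ Y, y q = a_q := by
      intro y hy
      rcases hYx y hy with h0 | h1
      · by_contra hyq
        obtain ⟨z, hz, hzq⟩ : ∃ z ∈ Z, z q ≠ y q := by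
          obtain ⟨z₁, hz₁, z₂, hz₂, hzne⟩ := exists_pair_of_line hn3 c2 hZl hZc
          by_cases h : z₁ q = y q
          · exact ⟨z₂, hz₂, fun h' => hzne (h.trans h'.symm)⟩
          · exact ⟨z₁, hz₁, h⟩
        rcases gX x₁ hx₁ x₂ hx₂ y hy z hz with h | h | h
        · have h' : y q = z q := by simpa [(hXl x₁ hx₁).2, (hXl x₂ hx₂).2, sub_eq_zero] using h
          exact hzq h'.symm
        · exact hxne (by simpa [hβ y hy, (hZl z hz).2, sub_eq_zero] using h)
        · exact h (by simp [(hXl x₁ hx₁).1, (hXl x₂ hx₂).1, h0, (hZl z hz).1])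
      · exact h1
    exact ⟨a_q, y₀ r, y₀ r, fun y hy => ⟨hYq y hy, hβ y hy⟩, hZl⟩

end Abstract

end FatPartners

end Summit.MatrixMultiplication.MatrixMultiplication.Theorems
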